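import Summits.HubbardSuperconductivity.HubbardSuperconductivity.Theses.FixedNodeShadow
import HarnessLib

/-!
# Crux `FnNodeRelease` (stmt-HubbardSuperconductivity-2104; route `FixedNodeShadow`, rank 3 "RELEASE")
— BIRTH SKELETON `Lines/birth.lean` (BC3)

THE CRUX (fixed; `Theses/FixedNodeShadow.lean`, decl `FnNodeRelease`, not restated here): for ALL
`U > 0`, `δ ∈ (0,1/2)`, real trial families `φ` and `a > 0` — IF the ANCHOR BODY holds at `(U,δ,φ,a)`
(eventually in even `L`, with `N = N_L = 2⌊(1-δ)L²/2⌋`: `φ_L` admissible and sector-supported, trial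
`d`-wave order `a·L⁴·‖φ_L‖² ≤ Re⟨φ_L, Δ_d†Δ_d φ_L⟩`, and EVERY normalised `(N,0)`-sector ground state of
the fixed-node shadow `F_L = FN(H_L, φ_L)` has `a·L⁴ ≤ Re⟨ψ, Δ_d†Δ_d ψ⟩`, `H_L = hubbardTorus 2 L 1 U`)
THEN `∃ a' > 0, ∃ L₁`, for every even `L ≥ L₁`: `φ_L` admissible and, for every `γ ∈ [0,1]`, every
normalised sector ground state `ψ` of the node-release matrix `H_γ = H_L + γ (F_L − H_L)` has
`a'·L⁴ ≤ Re⟨ψ, Δ_d†Δ_d ψ⟩`. Endpoints: `H_1 = F_L` (the shadow, where the anchor rules), `H_0 = H_L`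
(the summit's matrix).

THE LINE = the release path cut at its two natural joints in the deformation parameter `γ`, i.e.
at the point where the route's own handle degenerates. By `FnEnergyWindow` (F3, landed) the
node-crossing weight of a path ground state obeys `⟨ψ_γ, (F−H) ψ_γ⟩ ≤ (E_φ − E₀)/γ`: a genuine
handle on every CLOSED sub-path `[γ₀, 1]`, `γ₀ > 0`, and no handle at all at the released end
`γ → 0⁺`, where the bad hops return with full weight and `H_0 = H_L` carries the summit's
every-ground-state quantifier. Three stubs, one per regime:

1. `stub_openEnd` — RELEASE AWAY FROM THE RELEASED END (the bet WITH the handle): under the anchor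
   body, for every `γ₀ ∈ (0,1]` there are `a'(γ₀) > 0`, `L₁(γ₀)` such that every normalised sector
   ground state of `H_γ`, `γ ∈ [γ₀,1]`, is ordered `≥ a'(γ₀)·L⁴` on all even `L ≥ L₁(γ₀)`. At `γ₀ = 1`
   this is the anchor's shadow clause itself (`H_L + 1•(F_L − H_L) = F_L`; checked sorry-free in the
   planner's probe file), so the stub is inhabited-in-kind; for `γ₀ < 1` it is open: `H_γ` is NOT
   stoquastic in the signed basis for `γ < 1` (bad hops carry `(1−γ)H_{ss'}`), Perron uniqueness is
   lost, and the only rigorous order-stability theorems need a UNIFORM gap (Bravyi–Hastings–Michalakis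
   2010; Michalakis–Zwolak 2013) which a neutral superfluid's fixed-`N` sector does not have (phase
   mode, gap `∼ 1/L`). Handles: `⟨F−H⟩_γ ≤ ε_φ L²/γ₀` (F3) and the configuration-sparse support of
   `F − H` (bad hops only; F1 `FnDomination`, landed). Why it might fail: the crux's own — an
   admissible `φ` with an ordered shadow over a `(U,δ)` whose true physics along the path de-orders
   before `γ₀` (FN bias toward the guiding state; GKW2016 p. 383, BeccaSorella2017). Size: crux-sized
   on `[γ₀,1]`, but strictly weaker than the crux (misses `γ = 0`, the summit-relevant point).
2. `stub_noCollapse` — NO COLLAPSE OF THE ORDER CONSTANT AT THE RELEASED END: if (under the anchor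
   body) every closed sub-path `[γ₀,1]`, `γ₀ > 0`, carries eventual every-ground-state order with
   `γ₀`-dependent constants, then ONE constant `a' > 0` and ONE threshold `L₁` serve the whole
   half-open path `γ ∈ (0,1]`. Content: absence of a ground-state phase transition of the node-release
   family exactly AT `γ = 0⁺` (`a'(γ₀) ↛ 0`, `L₁(γ₀) ↛ ∞`); the numerical instrument is the route's K2
   γ-scan (`γ ∈ {1, 0.5, 0.25, → 0}`, SorellaCapriotti2000, Sorella2003). Not compactness bookkeeping:
   `[0,1]` is covered by no finite set of the `[γ₀,1]`, and model-free "pointwise ⇒ uniform" is false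
   (constants may degenerate at an endpoint) — cf. the negatives index: the abstract order-OPENNESS
   shape `AposterioriCapRg.KlsOrderOpenness` (stmt-1314) is refuted by helical perturbations; this stub
   quantifies over NO perturbation class (the family `H_γ` is fixed by `φ`), so it is not an instance.
   Why it might fail: a continuous transition of `H_γ` at `γ_c = 0` (order parameter of the path ground
   states vanishing as `γ → 0⁺` while every `[γ₀,1]` stays ordered). Size: M–L.
3. `stub_closedEnd` — THE CLOSED END `γ = 0` FOR EVERY GROUND STATE: uniform eventual order on the
   half-open path `(0,1]` (plus the anchor body) gives it on the closed path `[0,1]`, i.e. also for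
   EVERY normalised `(N_L,0)`-sector ground state of `H_0 = H_L` itself. At fixed `L` the ground
   states of `H_γ = H_L + γD` (`D ⪰ 0`, `Dφ_L = 0`, F1) accumulate as `γ → 0⁺` on the LOWEST
   eigenspace of `P₀ D P₀` inside the ground space `ran P₀` of `H_L` (first-order degenerate
   perturbation theory; Kato 1966 Ch. II, §6 for symmetric families), and `⟨Δ_d†Δ_d⟩` is continuous, so the inherited bound reaches
   exactly those ground states of `H_L` — all of them when the sector ground state of `H_L` is unique
   up to phase; on a degenerate ground space only the `D`-selected subspace is reached this way. The residual is the summit's EVERY-ground-state quantifier on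
   degenerate sector ground spaces of the pure Hubbard torus (open shells / momentum multiplets occur
   for infinitely many even `L` at fixed `δ`): the route header lists it as deliberately undecomposed
   ("the every-ground-state quantifier at γ < 1, generic-u-schur card"). Why it might fail: a
   degenerate `(N_L,0)` ground space of `H_L` containing a pair-disordered vector orthogonal to the
   `D`-selected subspace, for infinitely many even `L`. Size: M (finite-dimensional spectral
   perturbation + a symmetry/selection argument), the most tractable of the three.

COMPOSITION `FnNodeRelease_of : FnNodeRelease` (harness skeleton convention A12: concludes the route
decl BY NAME, no hypotheses, cites the three declared stubs by name; no `sorry` outside the stubs):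
given `U δ φ a`, the side conditions and the anchor body `hbody`,
`stub_closedEnd … hbody (stub_noCollapse … hbody (stub_openEnd … hbody))` yields `a' > 0`, `L₁` and
the every-ground-state bound on `γ ∈ Set.Icc 0 1`; the admissibility conjunct of the conclusion is
the anchor body's clause (i) from its own threshold `L₀`; take `max L₀ L₁`. Read with the stubs
abstracted this is the pure-logic implication
`stub_openEnd-sig → stub_noCollapse-sig → stub_closedEnd-sig → FnNodeRelease` (checked as a
hypotheses-only `example` in the planner's probe file, rc 0, no sorry).

DISPROOF USED: no `Cruxes/FnNodeRelease/Disproof.lean`, no `Theorems/FnNodeRelease/Negative/` exist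
(2026-08-17; `ledger crux ls stmt-HubbardSuperconductivity-2104`: files = []). `ledger negatives
--problem HubbardSuperconductivity` (2026-08-17, 2 entries: stmt-1180 `BreathingSelfDual`, the `L = 2`
artefact of the breathing family; stmt-1314 `KlsOrderOpenness`, abstract order-openness under a
perturbation CLASS, killed by a helical gauge twist): no stub is an instance — all three are
eventual-in-`L` statements about the ONE-parameter family `H_L + γ(FN(H_L,φ_L) − H_L)` of the given
trial family, with the momentum-zero `d`-wave pair field of the summit.

LEANS ON (landed, by name, for the stub provers — not used by the composition):
`FixedNodeShadow.FnDomination` (F1: `F − H ⪰ 0`, kernel `∋ φ`, `F = H + D`; proved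
`Theorems/FixedNodeShadowFnDomination.lean`), `FixedNodeShadow.FnSignedPerron` (F2; proved),
`FixedNodeShadow.FnEnergyWindow` (F3: the variational window / concavity in `γ`; proved),
`Literature.MathematicalPhysics.QuantumLattice.perronFrobenius_groundState_pos` (proved).

Sources: ten Haaf–van Bemmel–van Leeuwen–van Saarloos–Ceperley, PRB 51 (1995) 13039
(doi:10.1103/physrevb.51.13039); Sorella–Capriotti, PRB 61 (2000) 2599 (doi:10.1103/physrevb.61.2599);
S. Sorella, AIP Conf. Proc. 690 (2003) 318 (doi:10.1063/1.1632143); Becca–Sorella, *Quantum Monte Carlo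
Approaches for Correlated Systems* (CUP 2017, doi:10.1017/9781316417041);
Gubernatis–Kawashima–Werner (CUP 2016) §11.2–11.4 pp. 375–383; Bravyi–Hastings–Michalakis, JMP 51
(2010) 093512 (arXiv:1001.0344); Michalakis–Zwolak, CMP 322 (2013) 277 (arXiv:1109.1588); T. Kato,
*Perturbation Theory for Linear Operators* (1966) Ch. II (finite-dimensional analytic perturbation
theory; §6 symmetric families); Qin et al., PRX 10 (2020) 031016 (arXiv:1910.08931); Xu et al., Science
384 (2024) eadh7691 (arXiv:2303.08376). No definition is introduced; all statements are over existing
declarations (the fixed-node matrix is written inline exactly as in the route file).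
-/

noncomputable section

-- `dupNamespace`: the summit and the problem are both named `HubbardSuperconductivity` (layout D-0022)
set_option linter.dupNamespace false

namespace Summit.HubbardSuperconductivity.HubbardSuperconductivity.Cruxes.FnNodeRelease.Birth

open Matrix Filter
open Literature.Probability.LatticeModels Literature.MathematicalPhysics.QuantumLattice
open Summit.HubbardSuperconductivity.HubbardSuperconductivity.Theses.FixedNodeShadow (FnNodeRelease)

/-! ## The three stubs -/

/-- **STUB 1 `stub_openEnd` — RELEASE ON EVERY CLOSED SUB-PATH `[γ₀,1]`, `γ₀ > 0`** (the bet, with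
the energy-window handle `⟨F−H⟩_γ ≤ (E_φ−E₀)/γ₀` available). For all `U > 0`, `δ ∈ (0,1/2)`, `φ`,
`a > 0`: the anchor body at `(U,δ,φ,a)` (verbatim the hypothesis of `FnNodeRelease`) implies, for
every `γ₀ ∈ (0,1]`, an eventual (even `L ≥ L₁(γ₀)`), uniform-on-`[γ₀,1]`, EVERY-ground-state bound
`a'(γ₀)·L⁴ ≤ Re⟨ψ, Δ_d†Δ_d ψ⟩` for the normalised `(N_L, S^z=0)`-sector ground states of
`H_γ = H_L + γ(F_L − H_L)`, `H_L = hubbardTorus 2 L 1 U`, `F_L = FN(H_L,φ_L)` (inline). At `γ₀ = 1`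
it is the anchor's shadow clause; for `γ₀ < 1` open (no stoquasticity, no uniform gap:
Bravyi–Hastings–Michalakis 2010 does not apply). ten Haaf et al., PRB 51 (1995) 13039;
Sorella–Capriotti, PRB 61 (2000) 2599. -/
theorem stub_openEnd :
    ∀ (U δ : ℝ) (φ : (∀ L : ℕ, Finset (Orb (FermionTorus 2 L)) → ℝ)) (a : ℝ),
      0 < U → δ ∈ Set.Ioo (0:ℝ) (1/2) → 0 < a →
      (∃ L₀ : ℕ, ∀ (L : ℕ) [NeZero L], L₀ ≤ L → Even L → ∀ N : ℕ,
        N = 2 * ⌊(1 - δ) * (L : ℝ) ^ 2 / 2⌋₊ →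
        (∀ s, (s.card = N ∧ 2 * (s.filter (fun o => (ofLex o).2 = 0)).card = N) → φ L s ≠ 0) ∧
        (∀ s, ¬ (s.card = N ∧ 2 * (s.filter (fun o => (ofLex o).2 = 0)).card = N) → φ L s = 0) ∧
        a * (L : ℝ) ^ 4 * (∑ s, (φ L s) ^ 2) ≤
          (expect ((pairField dWaveFormFactor L)ᴴ * pairField dWaveFormFactor L)
            (fun s => ((φ L s : ℝ) : ℂ))).re ∧
        (∀ H, H = hubbardTorus 2 L 1 U → ∀ F, F = Matrix.of (fun s s' => if s = s' then H s s +
            ∑ s'', (if s'' ≠ s ∧ 0 < (H s s'').re * φ L s * φ L s'' then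
              ((((H s s'').re * φ L s'' / φ L s : ℝ)) : ℂ) else 0)
            else (if 0 < (H s s').re * φ L s * φ L s' then 0 else H s s')) →
          ∀ ψ, star ψ ⬝ᵥ ψ = 1 → IsGroundStateInSector F N 0 ψ →
            a * (L : ℝ) ^ 4 ≤
              (expect ((pairField dWaveFormFactor L)ᴴ * pairField dWaveFormFactor L) ψ).re)) →
      ∀ γ₀ ∈ Set.Ioc (0:ℝ) 1, ∃ a' : ℝ, 0 < a' ∧ ∃ L₁ : ℕ, ∀ (L : ℕ) [NeZero L], L₁ ≤ L → Even L →
        ∀ N : ℕ, N = 2 * ⌊(1 - δ) * (L : ℝ) ^ 2 / 2⌋₊ → ∀ γ ∈ Set.Icc γ₀ 1,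
        ∀ H, H = hubbardTorus 2 L 1 U → ∀ F, F = Matrix.of (fun s s' => if s = s' then H s s +
            ∑ s'', (if s'' ≠ s ∧ 0 < (H s s'').re * φ L s * φ L s'' then
              ((((H s s'').re * φ L s'' / φ L s : ℝ)) : ℂ) else 0)
            else (if 0 < (H s s').re * φ L s * φ L s' then 0 else H s s')) →
          ∀ ψ, star ψ ⬝ᵥ ψ = 1 → IsGroundStateInSector (H + (γ : ℂ) • (F - H)) N 0 ψ →
            a' * (L : ℝ) ^ 4 ≤
              (expect ((pairField dWaveFormFactor L)ᴴ * pairField dWaveFormFactor L) ψ).re := by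
  sorry

/-- **STUB 2 `stub_noCollapse` — NO COLLAPSE OF THE ORDER CONSTANT AT THE RELEASED END `γ → 0⁺`.**
For all `U > 0`, `δ ∈ (0,1/2)`, `φ`, `a > 0` with the anchor body: if every closed sub-path `[γ₀,1]`,
`γ₀ ∈ (0,1]`, carries an eventual every-ground-state bound with `γ₀`-dependent constants (the
conclusion of `stub_openEnd`), then a SINGLE `a' > 0` and threshold `L₁` serve the whole half-open
path `γ ∈ (0,1]`. Content: no ground-state phase transition of the node-release family at
`γ_c = 0⁺`; not compactness bookkeeping (no finite subcover of `(0,1]` by the `[γ₀,1]`; model-free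
"pointwise ⇒ uniform" is false at an endpoint). Numerical instrument: the route's K2 γ-scan.
Sorella–Capriotti, PRB 61 (2000) 2599; Sorella, AIP Conf. Proc. 690 (2003) 318; Becca–Sorella (CUP
2017). -/
theorem stub_noCollapse :
    ∀ (U δ : ℝ) (φ : (∀ L : ℕ, Finset (Orb (FermionTorus 2 L)) → ℝ)) (a : ℝ),
      0 < U → δ ∈ Set.Ioo (0:ℝ) (1/2) → 0 < a →
      (∃ L₀ : ℕ, ∀ (L : ℕ) [NeZero L], L₀ ≤ L → Even L → ∀ N : ℕ,
        N = 2 * ⌊(1 - δ) * (L : ℝ) ^ 2 / 2⌋₊ →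
        (∀ s, (s.card = N ∧ 2 * (s.filter (fun o => (ofLex o).2 = 0)).card = N) → φ L s ≠ 0) ∧
        (∀ s, ¬ (s.card = N ∧ 2 * (s.filter (fun o => (ofLex o).2 = 0)).card = N) → φ L s = 0) ∧
        a * (L : ℝ) ^ 4 * (∑ s, (φ L s) ^ 2) ≤
          (expect ((pairField dWaveFormFactor L)ᴴ * pairField dWaveFormFactor L)
            (fun s => ((φ L s : ℝ) : ℂ))).re ∧
        (∀ H, H = hubbardTorus 2 L 1 U → ∀ F, F = Matrix.of (fun s s' => if s = s' then H s s +
            ∑ s'', (if s'' ≠ s ∧ 0 < (H s s'').re * φ L s * φ L s'' then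
              ((((H s s'').re * φ L s'' / φ L s : ℝ)) : ℂ) else 0)
            else (if 0 < (H s s').re * φ L s * φ L s' then 0 else H s s')) →
          ∀ ψ, star ψ ⬝ᵥ ψ = 1 → IsGroundStateInSector F N 0 ψ →
            a * (L : ℝ) ^ 4 ≤
              (expect ((pairField dWaveFormFactor L)ᴴ * pairField dWaveFormFactor L) ψ).re)) →
      (∀ γ₀ ∈ Set.Ioc (0:ℝ) 1, ∃ a' : ℝ, 0 < a' ∧ ∃ L₁ : ℕ, ∀ (L : ℕ) [NeZero L], L₁ ≤ L → Even L →
        ∀ N : ℕ, N = 2 * ⌊(1 - δ) * (L : ℝ) ^ 2 / 2⌋₊ → ∀ γ ∈ Set.Icc γ₀ 1,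
        ∀ H, H = hubbardTorus 2 L 1 U → ∀ F, F = Matrix.of (fun s s' => if s = s' then H s s +
            ∑ s'', (if s'' ≠ s ∧ 0 < (H s s'').re * φ L s * φ L s'' then
              ((((H s s'').re * φ L s'' / φ L s : ℝ)) : ℂ) else 0)
            else (if 0 < (H s s').re * φ L s * φ L s' then 0 else H s s')) →
          ∀ ψ, star ψ ⬝ᵥ ψ = 1 → IsGroundStateInSector (H + (γ : ℂ) • (F - H)) N 0 ψ →
            a' * (L : ℝ) ^ 4 ≤
              (expect ((pairField dWaveFormFactor L)ᴴ * pairField dWaveFormFactor L) ψ).re) →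
      ∃ a' : ℝ, 0 < a' ∧ ∃ L₁ : ℕ, ∀ (L : ℕ) [NeZero L], L₁ ≤ L → Even L →
        ∀ N : ℕ, N = 2 * ⌊(1 - δ) * (L : ℝ) ^ 2 / 2⌋₊ → ∀ γ ∈ Set.Ioc (0:ℝ) 1,
        ∀ H, H = hubbardTorus 2 L 1 U → ∀ F, F = Matrix.of (fun s s' => if s = s' then H s s +
            ∑ s'', (if s'' ≠ s ∧ 0 < (H s s'').re * φ L s * φ L s'' then
              ((((H s s'').re * φ L s'' / φ L s : ℝ)) : ℂ) else 0)
            else (if 0 < (H s s').re * φ L s * φ L s' then 0 else H s s')) →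
          ∀ ψ, star ψ ⬝ᵥ ψ = 1 → IsGroundStateInSector (H + (γ : ℂ) • (F - H)) N 0 ψ →
            a' * (L : ℝ) ^ 4 ≤
              (expect ((pairField dWaveFormFactor L)ᴴ * pairField dWaveFormFactor L) ψ).re := by
  sorry

/-- **STUB 3 `stub_closedEnd` — THE CLOSED END `γ = 0` FOR EVERY GROUND STATE.** For all `U > 0`,
`δ ∈ (0,1/2)`, `φ`, `a > 0` with the anchor body: a uniform eventual every-ground-state bound on the
half-open path `γ ∈ (0,1]` extends (new constant, new threshold allowed) to the closed path
`γ ∈ [0,1]`, i.e. to EVERY normalised `(N_L,0)`-sector ground state of `H_0 = H_L = hubbardTorus 2 L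
1 U` as well. At fixed `L`, ground states of `H_L + γD` (`D = F_L − H_L ⪰ 0`, `Dφ_L = 0`,
`FnDomination`) accumulate as `γ → 0⁺` on the lowest eigenspace of `P₀DP₀` inside the ground space of
`H_L` and `⟨Δ_d†Δ_d⟩` is continuous (Kato 1966 Ch. II) — this reaches all ground states when the sector
ground state is unique up to phase (on a degenerate ground space only the `D`-selected subspace); the
residual is the summit's
every-ground-state quantifier on degenerate sector ground spaces (route header: "generic-u-schur",
deliberately undecomposed). T. Kato (1966) Ch. II; ten Haaf et al., PRB 51 (1995) 13039. -/
theorem stub_closedEnd :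
    ∀ (U δ : ℝ) (φ : (∀ L : ℕ, Finset (Orb (FermionTorus 2 L)) → ℝ)) (a : ℝ),
      0 < U → δ ∈ Set.Ioo (0:ℝ) (1/2) → 0 < a →
      (∃ L₀ : ℕ, ∀ (L : ℕ) [NeZero L], L₀ ≤ L → Even L → ∀ N : ℕ,
        N = 2 * ⌊(1 - δ) * (L : ℝ) ^ 2 / 2⌋₊ →
        (∀ s, (s.card = N ∧ 2 * (s.filter (fun o => (ofLex o).2 = 0)).card = N) → φ L s ≠ 0) ∧
        (∀ s, ¬ (s.card = N ∧ 2 * (s.filter (fun o => (ofLex o).2 = 0)).card = N) → φ L s = 0) ∧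
        a * (L : ℝ) ^ 4 * (∑ s, (φ L s) ^ 2) ≤
          (expect ((pairField dWaveFormFactor L)ᴴ * pairField dWaveFormFactor L)
            (fun s => ((φ L s : ℝ) : ℂ))).re ∧
        (∀ H, H = hubbardTorus 2 L 1 U → ∀ F, F = Matrix.of (fun s s' => if s = s' then H s s +
            ∑ s'', (if s'' ≠ s ∧ 0 < (H s s'').re * φ L s * φ L s'' then
              ((((H s s'').re * φ L s'' / φ L s : ℝ)) : ℂ) else 0)
            else (if 0 < (H s s').re * φ L s * φ L s' then 0 else H s s')) →
          ∀ ψ, star ψ ⬝ᵥ ψ = 1 → IsGroundStateInSector F N 0 ψ →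
            a * (L : ℝ) ^ 4 ≤
              (expect ((pairField dWaveFormFactor L)ᴴ * pairField dWaveFormFactor L) ψ).re)) →
      (∃ a' : ℝ, 0 < a' ∧ ∃ L₁ : ℕ, ∀ (L : ℕ) [NeZero L], L₁ ≤ L → Even L →
        ∀ N : ℕ, N = 2 * ⌊(1 - δ) * (L : ℝ) ^ 2 / 2⌋₊ → ∀ γ ∈ Set.Ioc (0:ℝ) 1,
        ∀ H, H = hubbardTorus 2 L 1 U → ∀ F, F = Matrix.of (fun s s' => if s = s' then H s s +
            ∑ s'', (if s'' ≠ s ∧ 0 < (H s s'').re * φ L s * φ L s'' then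
              ((((H s s'').re * φ L s'' / φ L s : ℝ)) : ℂ) else 0)
            else (if 0 < (H s s').re * φ L s * φ L s' then 0 else H s s')) →
          ∀ ψ, star ψ ⬝ᵥ ψ = 1 → IsGroundStateInSector (H + (γ : ℂ) • (F - H)) N 0 ψ →
            a' * (L : ℝ) ^ 4 ≤
              (expect ((pairField dWaveFormFactor L)ᴴ * pairField dWaveFormFactor L) ψ).re) →
      ∃ a' : ℝ, 0 < a' ∧ ∃ L₁ : ℕ, ∀ (L : ℕ) [NeZero L], L₁ ≤ L → Even L →
        ∀ N : ℕ, N = 2 * ⌊(1 - δ) * (L : ℝ) ^ 2 / 2⌋₊ → ∀ γ ∈ Set.Icc (0:ℝ) 1,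
        ∀ H, H = hubbardTorus 2 L 1 U → ∀ F, F = Matrix.of (fun s s' => if s = s' then H s s +
            ∑ s'', (if s'' ≠ s ∧ 0 < (H s s'').re * φ L s * φ L s'' then
              ((((H s s'').re * φ L s'' / φ L s : ℝ)) : ℂ) else 0)
            else (if 0 < (H s s').re * φ L s * φ L s' then 0 else H s s')) →
          ∀ ψ, star ψ ⬝ᵥ ψ = 1 → IsGroundStateInSector (H + (γ : ℂ) • (F - H)) N 0 ψ →
            a' * (L : ℝ) ^ 4 ≤
              (expect ((pairField dWaveFormFactor L)ᴴ * pairField dWaveFormFactor L) ψ).re := by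
  sorry

/-! ## The composition: the three stubs prove the crux BY NAME -/

/-- **`FnNodeRelease` from the three stubs** (A12 skeleton: concludes the route decl
`FixedNodeShadow.FnNodeRelease` by name; the only `sorry`s are inside `stub_openEnd`,
`stub_noCollapse`, `stub_closedEnd`). Given `(U,δ,φ,a)` and the anchor body: stub 1 gives the
every-GS order bound on every closed sub-path `[γ₀,1]`, stub 2 makes the constants uniform on the
half-open path `(0,1]`, stub 3 closes the path at `γ = 0` for every ground state; the admissibility
conjunct is clause (i) of the anchor body (threshold `max L₀ L₁`). [folklore] -/
theorem FnNodeRelease_of : FnNodeRelease := by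
  intro U δ φ a hU hδ ha hbody
  obtain ⟨a', ha', L₁, hpath⟩ := stub_closedEnd U δ φ a hU hδ ha hbody
    (stub_noCollapse U δ φ a hU hδ ha hbody (stub_openEnd U δ φ a hU hδ ha hbody))
  obtain ⟨L₀, hanchor⟩ := hbody
  refine ⟨a', ha', max L₀ L₁, ?_⟩
  intro L _ hL hLe N hN
  refine ⟨(hanchor L ((le_max_left L₀ L₁).trans hL) hLe N hN).1, ?_⟩
  intro γ hγ H hH F hF ψ hψ hgs
  exact hpath L ((le_max_right L₀ L₁).trans hL) hLe N hN γ hγ H hH F hF ψ hψ hgs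

end Summit.HubbardSuperconductivity.HubbardSuperconductivity.Cruxes.FnNodeRelease.Birth

end
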